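/-
Copyright (c) 2026. All rights reserved.
Released under Apache 2.0 license as described in the file LICENSE.
-/
import Literature.MathematicalPhysics.QuantumLattice.HartreeFockSDWThermodynamicLimit
import Literature.MathematicalPhysics.QuantumLattice.HeisenbergClusterProductUpperBound
import HarnessLib

/-!
# Hartree–Fock upper bounds from Bloch (magnetic-cell periodic) Slater states on the Hubbard torus

Topic `MathematicalPhysics/QuantumLattice`, family `hubbard`; continuation of
`HartreeFockUpperBound.lean` (`HartreeFock.groundEnergyAt_le_hfEnergy`: on any finite graph
`E₀(N) ≤ re E_HF(P)` for every orthogonal projection `P` with `tr P = N`) and of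
`HartreeFockSDWTorus.lean` (the two-sublattice spin-density wave). Here the one-body projection is a
general COLLINEAR state that is periodic under a MAGNETIC SUPERLATTICE of the torus `(ℤ/Lℤ)^d`:
the torus is cut into `Π_i k i` rectangular cells of sides `M i` (`k i · M i = L`, the tree's
`HeisenbergTL.boxBlockDecomp`), and for every spin `σ` and every momentum `κ ∈ Π_i ℤ/(k i)ℤ` of the
cell lattice a matrix `Q σ κ` on the cell positions `Π_i ℤ/(M i)ℤ` is given. The **Bloch matrix**

  `P_σ(x, y) = |k|⁻¹ Σ_κ χ_κ(X - Y) · Q σ κ (x̄, ȳ)`     (`x = (X, x̄)` = (cell, position in the cell))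

is the one-body matrix whose restriction to cell momentum `κ` is `Q σ κ` (unrestricted Hartree–Fock
states with a magnetic unit cell: stripes, spirals' collinear cousins, polarised and paramagnetic
seas are all of this form). Results (all `d`, all real `t, U`, `L ≥ 3`):

* `blochMatrix_mul`, `conjTranspose_blochMatrix`, `trace_blochMatrix` — the Bloch assembly is a
  `*`-homomorphism with `tr P_σ = Σ_κ tr Q σ κ`; so `P = P↑ ⊕ P↓` is an orthogonal projection as soon
  as every `Q σ κ` is;
* **`hfEnergy_blochState`** — the Hartree–Fock functional of `P` is `|k|`-fold the CELL expression
  `blochEnergy`: kinetic part `-t Σ_σ Σ_κ Σ_i Σ_{x̄} [θ Q σ κ (x̄+eᵢ, x̄) + conj θ · Q σ κ (x̄, x̄+eᵢ)]`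
  with the Bloch phase `θ = χ_κ(eᵢ)` on the bonds leaving the cell through the face `x̄ᵢ = M i - 1`
  and `θ = 1` inside, interaction `U |k| Σ_{x̄} ρ↑(x̄) ρ↓(x̄)` with the cell densities
  `ρ_σ(x̄) = |k|⁻¹ Σ_κ Q σ κ (x̄, x̄)`;
* **`hubbardTorus_groundEnergyAt_le_bloch`** — `E_{(ℤ/Lℤ)^d}(t,U;N) ≤ re blochEnergy` whenever the
  `Q σ κ` are Hermitian idempotents with `Σ_{σ,κ} tr Q σ κ = N`;
* **`energyDensity2D_le_bloch`** — `d = 2`, with the tree's tiling theorem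
  `ThermodynamicLimit.energyDensity2D_le`: for `U ≥ 0`,
  `e(t,U; 2m/L²) ≤ re blochEnergy / L² + 16|t|/L`.

This is the soundness theorem behind certified "UHF" thermodynamic-limit upper bounds: a certificate
fixes `L`, the cell, the matrices `Q σ κ` (e.g. the spectral projections below the Fermi level of the
Bloch blocks of a mean-field Hamiltonian — the theorem needs only `Q² = Q = Qᴴ` and the total trace)
and encloses the finite expression `blochEnergy`; everything else is this file. The `2 × 1`-cell,
`Q` = SDW projections case is `hubbardTorus_groundEnergyAt_le_sdw` of `HartreeFockSDWTorus.lean`.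

Everything is proved; definitions have bodies; no named facts.

## Mathlib / tree search

Tree (REUSED): `HartreeFock.groundEnergyAt_le_hfEnergy`, `HartreeFock.spinBlock`,
`hfEnergy_spinBlock`, `conjTranspose_spinBlock`, `spinBlock_mul_spinBlock`, `trace_spinBlock`
(`HartreeFockSDWTorus`), `HeisenbergTL.boxBlockDecomp` and its face lemmas
`boxBlockDecomp_snd_add_single`, `boxBlockDecomp_fst_add_single_of_lt/_of_eq`,
`card_rectTorusSite_eq_prod` (`HeisenbergClusterProductUpperBound`), `sum_ite_torusGraph_adj`,
`FermionTorus.sum_eq_sum_torusSite` (`HubbardFreePropagator`), `ZMod.stdAddChar`,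
`AddChar.sum_mulShift`, `ZMod.isPrimitive_stdAddChar` (characters; the tree's `torusChar` is the
equal-sides case), `ThermodynamicLimit.energyDensity2D_le`, `groundEnergyAt_fermionTorusGraph_two`.
`lean search 'bloch|Bloch|superlattice|magnetic cell'`: only Bloch's theorem on flux / band theory
docstrings; no Bloch-assembled density matrices in the tree.

## References

* V. Bach, E. H. Lieb, J. P. Solovej, *Generalized Hartree–Fock theory and the Hubbard model*,
  J. Stat. Phys. 76 (1994) 3, eqs. (2c.8), (2c.36), (3a.2). [BachLiebSolovej1994]
* J. Xu, C.-C. Chang, E. J. Walter, S. Zhang, *Spin- and charge-density waves in the Hartree–Fock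
  ground state of the two-dimensional Hubbard model*, J. Phys.: Condens. Matter 23 (2011) 505601,
  §2 (supercell Bloch reduction of the UHF equations). [folklore]
-/

noncomputable section

namespace Literature.MathematicalPhysics.QuantumLattice

namespace HartreeFock

open Matrix Finset Literature.Probability.LatticeModels HeisenbergTL
  Literature.MathematicalPhysics.QuantumLattice.LangerMattis ThermodynamicLimit
open scoped ComplexConjugate

/-! ### Characters of the cell lattice `Π_i ℤ/(k i)ℤ` -/

section BlockChar

variable {d : ℕ} {k : Fin d → ℕ} [∀ i, NeZero (k i)]

/-- The character `χ_κ(X) = Π_i e^{2πi κ_i X_i / k_i}` of the finite abelian group `Π_i ℤ/(k i)ℤ`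
(cell momenta of a rectangular superlattice; the tree's `torusChar` is the case of equal sides).
[folklore] -/
def blockChar (κ X : RectTorusSite k) : ℂ := ∏ i, (ZMod.stdAddChar (κ i * X i) : ℂ)

/-- `χ_κ(X) = χ_X(κ)`. [folklore] -/
theorem blockChar_comm (κ X : RectTorusSite k) : blockChar κ X = blockChar X κ := by
  simp [blockChar, mul_comm]

/-- `χ_κ(0) = 1`. [folklore] -/
@[simp] theorem blockChar_zero_right (κ : RectTorusSite k) : blockChar κ 0 = 1 := by
  simp [blockChar]

/-- `χ_κ(X + Y) = χ_κ(X) χ_κ(Y)`. [folklore] -/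
theorem blockChar_add_right (κ X Y : RectTorusSite k) :
    blockChar κ (X + Y) = blockChar κ X * blockChar κ Y := by
  simp [blockChar, mul_add, AddChar.map_add_eq_mul, prod_mul_distrib]

/-- `χ_κ(-X) = conj χ_κ(X)`. [folklore] -/
theorem blockChar_neg_right (κ X : RectTorusSite k) : blockChar κ (-X) = conj (blockChar κ X) := by
  simp [blockChar, AddChar.map_neg_eq_conj, map_prod]

/-- `χ_κ(X - Y) = χ_κ(X) conj χ_κ(Y)`. [folklore] -/
theorem blockChar_sub_right (κ X Y : RectTorusSite k) :
    blockChar κ (X - Y) = blockChar κ X * conj (blockChar κ Y) := by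
  rw [sub_eq_add_neg, blockChar_add_right, blockChar_neg_right]

/-- `χ_{κ - κ'}(X) = χ_κ(X) conj χ_{κ'}(X)`. [folklore] -/
theorem blockChar_sub_left (κ κ' X : RectTorusSite k) :
    blockChar (κ - κ') X = blockChar κ X * conj (blockChar κ' X) := by
  rw [blockChar_comm, blockChar_sub_right, blockChar_comm X κ, blockChar_comm X κ']

/-- `χ_κ(X) conj χ_κ(X) = 1`. [folklore] -/
theorem blockChar_mul_conj (κ X : RectTorusSite k) : blockChar κ X * conj (blockChar κ X) = 1 := by
  rw [← blockChar_sub_right, sub_self, blockChar_zero_right]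

/-- **The Bloch phase across a face**: `χ_κ(eᵢ) = e(κᵢ) = exp(2πi κᵢ.val / k i)`
(Mathlib `ZMod.stdAddChar`, `ZMod.stdAddChar_apply`). [folklore] -/
theorem blockChar_single (κ : RectTorusSite k) (i : Fin d) :
    blockChar κ (Pi.single i 1) = (ZMod.stdAddChar (κ i) : ℂ) := by
  unfold blockChar
  rw [Finset.prod_eq_single i (fun j _ hj => by
      rw [Pi.single_eq_of_ne hj, mul_zero, AddChar.map_zero_eq_one])
    (fun h => absurd (Finset.mem_univ i) h), Pi.single_eq_same, mul_one]

/-- **Orthogonality of the cell-lattice characters**: `Σ_κ χ_κ(X) = |k|` if `X = 0`, else `0`.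
[folklore] -/
theorem sum_blockChar_left (X : RectTorusSite k) :
    ∑ κ, blockChar κ X = if X = 0 then (Fintype.card (RectTorusSite k) : ℂ) else 0 := by
  classical
  have h1 : ∀ i, ∑ a : ZMod (k i), (ZMod.stdAddChar (a * X i) : ℂ) =
      if X i = 0 then (k i : ℂ) else 0 := fun i => by
    rw [AddChar.sum_mulShift (X i) (ZMod.isPrimitive_stdAddChar (k i)), ZMod.card, Nat.cast_ite,
      Nat.cast_zero]
  have : ∑ κ : RectTorusSite k, blockChar κ X =
      ∏ i, ∑ a : ZMod (k i), (ZMod.stdAddChar (a * X i) : ℂ) := by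
    rw [Finset.prod_univ_sum]
    simp [blockChar, Fintype.piFinset_univ]
  rw [this]
  simp_rw [h1]
  split_ifs with hx
  · simp [hx]
  · obtain ⟨i, hi⟩ : ∃ i, X i ≠ 0 := by
      by_contra h
      push Not at h
      exact hx (funext h)
    exact Finset.prod_eq_zero (Finset.mem_univ i) (if_neg hi)

/-- Orthogonality, summed over the group: `Σ_X χ_κ(X) = |k|` if `κ = 0`, else `0`. [folklore] -/
theorem sum_blockChar_right (κ : RectTorusSite k) :
    ∑ X, blockChar κ X = if κ = 0 then (Fintype.card (RectTorusSite k) : ℂ) else 0 := by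
  simp_rw [blockChar_comm κ]
  exact sum_blockChar_left κ

/-- The convolution identity behind `P² = P`:
`Σ_Y χ_κ(X - Y) χ_{κ'}(Y - Z) = [κ = κ'] · |k| · χ_κ(X - Z)`. [folklore] -/
theorem sum_blockChar_sub_mul_blockChar_sub (κ κ' X Z : RectTorusSite k) :
    ∑ Y, blockChar κ (X - Y) * blockChar κ' (Y - Z) =
      if κ = κ' then (Fintype.card (RectTorusSite k) : ℂ) * blockChar κ (X - Z) else 0 := by
  have hterm : ∀ Y, blockChar κ (X - Y) * blockChar κ' (Y - Z) =
      blockChar κ (X - Z) * blockChar (κ' - κ) (Y - Z) := fun Y => by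
    rw [show X - Y = (X - Z) + -(Y - Z) by abel, blockChar_add_right, blockChar_neg_right,
      blockChar_sub_left]
    ring
  simp_rw [hterm]
  rw [← Finset.mul_sum,
    show ∑ Y, blockChar (κ' - κ) (Y - Z) = ∑ W, blockChar (κ' - κ) W from
      Fintype.sum_equiv (Equiv.subRight Z) _ _ fun _ => rfl,
    sum_blockChar_right]
  by_cases h : κ = κ'
  · subst h
    rw [sub_self, if_pos rfl, if_pos rfl, mul_comm]
  · rw [if_neg (sub_ne_zero.mpr (Ne.symm h)), if_neg h, mul_zero]

end BlockChar

/-! ### Cells of the torus and the Bloch matrix -/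

section Bloch

variable {d L : ℕ} [NeZero L] {k M : Fin d → ℕ} [∀ i, NeZero (k i)] [∀ i, NeZero (M i)]
  (hkM : ∀ i, k i * M i = L)

/-- The cell (block) of a torus site. [folklore] -/
def cellIndex (x : FermionTorus d L) : RectTorusSite k := (boxBlockDecomp L k M hkM x.toTorusSite).1

/-- The position of a torus site inside its cell. [folklore] -/
def cellPos (x : FermionTorus d L) : RectTorusSite M := (boxBlockDecomp L k M hkM x.toTorusSite).2

/-- The torus site with given cell and position. [folklore] -/
def ofCellPos (X : RectTorusSite k) (p : RectTorusSite M) : FermionTorus d L :=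
  FermionTorus.ofTorusSite ((boxBlockDecomp L k M hkM).symm (X, p))

/-- The cell of the site with cell `X` and position `p` is `X`. [folklore] -/
@[simp] theorem cellIndex_ofCellPos (X : RectTorusSite k) (p : RectTorusSite M) :
    cellIndex hkM (ofCellPos hkM X p) = X := by
  simp [cellIndex, ofCellPos]

/-- The position of the site with cell `X` and position `p` is `p`. [folklore] -/
@[simp] theorem cellPos_ofCellPos (X : RectTorusSite k) (p : RectTorusSite M) :
    cellPos hkM (ofCellPos hkM X p) = p := by
  simp [cellPos, ofCellPos]

/-- **Sums over the torus are sums over cells and positions.** [folklore] -/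
theorem sum_eq_sum_cell {A : Type*} [AddCommMonoid A] (f : FermionTorus d L → A) :
    ∑ x, f x = ∑ X : RectTorusSite k, ∑ p : RectTorusSite M, f (ofCellPos hkM X p) := by
  rw [FermionTorus.sum_eq_sum_torusSite, ← Fintype.sum_prod_type']
  exact Fintype.sum_equiv (boxBlockDecomp L k M hkM) _ _ fun z => by
    simp [ofCellPos]

/-- The neighbour `x + eᵢ` of a fermionic torus site. [folklore] -/
def stepSite (x : FermionTorus d L) (i : Fin d) : FermionTorus d L :=
  FermionTorus.ofTorusSite (x.toTorusSite + Pi.single i 1)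

/-- The position of `x + eᵢ` is the position of `x` plus `eᵢ` (mod the cell sides). [folklore] -/
theorem cellPos_stepSite (x : FermionTorus d L) (i : Fin d) :
    cellPos hkM (stepSite x i) = cellPos hkM x + Pi.single i 1 := by
  simp only [cellPos, stepSite, FermionTorus.toTorusSite_ofTorusSite]
  exact boxBlockDecomp_snd_add_single hkM _ i

/-- **The Bloch phase of a bond**: `θ_κ,i(x̄) = 1` if the bond `x̄ → x̄ + eᵢ` stays in the cell,
`= χ_κ(eᵢ)` if it leaves through the face `x̄ᵢ = M i - 1`. [folklore] -/
def facePhase (κ : RectTorusSite k) (i : Fin d) (p : RectTorusSite M) : ℂ :=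
  if (p i).val + 1 < M i then 1 else blockChar κ (Pi.single i 1)

/-- The cell of `x + eᵢ` minus the cell of `x` is `0` inside the cell and `eᵢ` across a face, so
`χ_κ(cellIndex(x+eᵢ) - cellIndex x) = θ_κ,i(cellPos x)`. [folklore] -/
theorem blockChar_cellIndex_stepSite_sub (κ : RectTorusSite k) (x : FermionTorus d L) (i : Fin d) :
    blockChar κ (cellIndex hkM (stepSite x i) - cellIndex hkM x) = facePhase κ i (cellPos hkM x) := by
  simp only [cellIndex, cellPos, stepSite, FermionTorus.toTorusSite_ofTorusSite, facePhase]
  split_ifs with h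
  · rw [boxBlockDecomp_fst_add_single_of_lt hkM _ i h, sub_self, blockChar_zero_right]
  · have hlt := ZMod.val_lt ((boxBlockDecomp L k M hkM x.toTorusSite).2 i)
    rw [boxBlockDecomp_fst_add_single_of_eq hkM _ i (by omega), add_sub_cancel_left]

omit [∀ i, NeZero (M i)] in
/-- `|θ| = 1`: `conj θ · θ = 1`. [folklore] -/
theorem conj_facePhase_mul_self (κ : RectTorusSite k) (i : Fin d) (p : RectTorusSite M) :
    conj (facePhase (k := k) κ i p) * facePhase κ i p = 1 := by
  unfold facePhase
  split_ifs
  · simp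
  · rw [mul_comm, blockChar_mul_conj]

variable (Q R : RectTorusSite k → Matrix (RectTorusSite M) (RectTorusSite M) ℂ)

/-- **The Bloch matrix** assembled from per-cell-momentum matrices `Q κ` on the cell:
`P(x, y) = |k|⁻¹ Σ_κ χ_κ(cellIndex x - cellIndex y) · Q κ (cellPos x) (cellPos y)` — the superlattice-periodic
one-body matrix whose block at cell momentum `κ` is `Q κ`. BLS94 §3a (periodic HF states);
Xu–Chang–Walter–Zhang 2011 §2. [cite: BachLiebSolovej1994, eq. (3a.2)] -/
def blochMatrix : Matrix (FermionTorus d L) (FermionTorus d L) ℂ :=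
  Matrix.of fun x y => ((Fintype.card (RectTorusSite k) : ℂ))⁻¹ *
    ∑ κ, blockChar κ (cellIndex hkM x - cellIndex hkM y) * Q κ (cellPos hkM x) (cellPos hkM y)

omit [NeZero L] in
/-- Entries of the Bloch matrix. [folklore] -/
theorem blochMatrix_apply (x y : FermionTorus d L) :
    blochMatrix hkM Q x y = ((Fintype.card (RectTorusSite k) : ℂ))⁻¹ *
      ∑ κ, blockChar κ (cellIndex hkM x - cellIndex hkM y) * Q κ (cellPos hkM x) (cellPos hkM y) := rfl

omit [∀ i, NeZero (M i)] in
/-- `|k| ≠ 0`. [folklore] -/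
theorem card_cells_ne_zero : (Fintype.card (RectTorusSite k) : ℂ) ≠ 0 :=
  Nat.cast_ne_zero.2 Fintype.card_ne_zero

omit [NeZero L] in
/-- `(blochMatrix Q)ᴴ = blochMatrix (Qᴴ)`. [folklore] -/
theorem conjTranspose_blochMatrix :
    (blochMatrix hkM Q)ᴴ = blochMatrix hkM fun κ => (Q κ)ᴴ := by
  ext x y
  rw [conjTranspose_apply, blochMatrix_apply, blochMatrix_apply, star_mul', star_sum]
  have hc : star (((Fintype.card (RectTorusSite k) : ℂ))⁻¹) =
      ((Fintype.card (RectTorusSite k) : ℂ))⁻¹ := by simp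
  rw [hc]
  congr 1
  refine Finset.sum_congr rfl fun κ _ => ?_
  rw [star_mul', conjTranspose_apply, show cellIndex hkM x - cellIndex hkM y = -(cellIndex hkM y - cellIndex hkM x) by abel,
    blockChar_neg_right]
  rfl

/-- **`blochMatrix` is multiplicative**: `blochMatrix Q · blochMatrix R = blochMatrix (Q R)`
(orthogonality of the cell-lattice characters). [folklore] -/
theorem blochMatrix_mul :
    blochMatrix hkM Q * blochMatrix hkM R = blochMatrix hkM fun κ => Q κ * R κ := by
  ext x z
  set c : ℂ := (Fintype.card (RectTorusSite k) : ℂ) with hc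
  have hc0 : c ≠ 0 := card_cells_ne_zero
  rw [Matrix.mul_apply, blochMatrix_apply, sum_eq_sum_cell hkM]
  simp only [blochMatrix_apply, cellIndex_ofCellPos, cellPos_ofCellPos]
  -- expand the product of the two momentum sums
  have hexp : ∀ (X : RectTorusSite k) (p : RectTorusSite M),
      c⁻¹ * (∑ κ, blockChar κ (cellIndex hkM x - X) * Q κ (cellPos hkM x) p) *
        (c⁻¹ * ∑ κ', blockChar κ' (X - cellIndex hkM z) * R κ' p (cellPos hkM z)) =
      c⁻¹ * c⁻¹ * ∑ κ, ∑ κ', (Q κ (cellPos hkM x) p * R κ' p (cellPos hkM z)) *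
        (blockChar κ (cellIndex hkM x - X) * blockChar κ' (X - cellIndex hkM z)) := by
    intro X p
    rw [mul_mul_mul_comm, Finset.sum_mul_sum]
    congr 1
    refine Finset.sum_congr rfl fun κ _ => Finset.sum_congr rfl fun κ' _ => ?_
    ring
  simp_rw [← hc, hexp]
  -- the cell sum `Σ_X` first: orthogonality of the characters
  have hinner : ∀ p : RectTorusSite M,
      ∑ X : RectTorusSite k, ∑ κ, ∑ κ', Q κ (cellPos hkM x) p * R κ' p (cellPos hkM z) *
        (blockChar κ (cellIndex hkM x - X) * blockChar κ' (X - cellIndex hkM z)) =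
      ∑ κ, c * (Q κ (cellPos hkM x) p * R κ p (cellPos hkM z)) * blockChar κ (cellIndex hkM x - cellIndex hkM z) := by
    intro p
    rw [Finset.sum_comm]
    refine Finset.sum_congr rfl fun κ _ => ?_
    rw [Finset.sum_comm]
    simp_rw [← Finset.mul_sum, sum_blockChar_sub_mul_blockChar_sub, mul_ite, mul_zero]
    rw [Finset.sum_ite_eq]
    simp only [Finset.mem_univ, if_true, ← hc]
    ring
  have hswap : ∑ X : RectTorusSite k, ∑ p : RectTorusSite M, c⁻¹ * c⁻¹ *
      ∑ κ, ∑ κ', Q κ (cellPos hkM x) p * R κ' p (cellPos hkM z) *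
        (blockChar κ (cellIndex hkM x - X) * blockChar κ' (X - cellIndex hkM z)) =
      c⁻¹ * c⁻¹ * ∑ p : RectTorusSite M, ∑ κ, c * (Q κ (cellPos hkM x) p * R κ p (cellPos hkM z)) *
        blockChar κ (cellIndex hkM x - cellIndex hkM z) := by
    rw [Finset.sum_comm, Finset.mul_sum]
    refine Finset.sum_congr rfl fun p _ => ?_
    rw [← Finset.mul_sum, hinner]
  rw [hswap, Finset.sum_comm]
  simp_rw [Matrix.mul_apply, Finset.mul_sum]
  refine Finset.sum_congr rfl fun κ _ => Finset.sum_congr rfl fun p _ => ?_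
  field_simp

/-- **`tr (blochMatrix Q) = Σ_κ tr (Q κ)`**. [folklore] -/
theorem trace_blochMatrix : (blochMatrix hkM Q).trace = ∑ κ, (Q κ).trace := by
  simp only [Matrix.trace, Matrix.diag_apply]
  rw [sum_eq_sum_cell hkM]
  simp only [blochMatrix_apply, cellIndex_ofCellPos, cellPos_ofCellPos, sub_self, blockChar_zero_right, one_mul]
  rw [Finset.sum_const, Finset.card_univ, nsmul_eq_mul, Finset.sum_comm]
  simp_rw [← Finset.mul_sum]
  rw [← mul_assoc, mul_inv_cancel₀ card_cells_ne_zero, one_mul]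

/-- The cell density: `P(x, x) = ρ(cellPos x)`, `ρ(x̄) = |k|⁻¹ Σ_κ Q κ (x̄, x̄)`. [folklore] -/
def blochDensity (p : RectTorusSite M) : ℂ :=
  ((Fintype.card (RectTorusSite k) : ℂ))⁻¹ * ∑ κ, Q κ p p

omit [NeZero L] in
/-- Diagonal entries of the Bloch matrix are the cell densities. [folklore] -/
theorem blochMatrix_apply_self (x : FermionTorus d L) :
    blochMatrix hkM Q x x = blochDensity (k := k) Q (cellPos hkM x) := by
  simp [blochMatrix_apply, blochDensity]

/-- Forward bond entries: `P(x + eᵢ, x) = |k|⁻¹ Σ_κ θ_κ,i(x̄) Q κ (x̄ + eᵢ, x̄)`. [folklore] -/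
theorem blochMatrix_stepSite_left (x : FermionTorus d L) (i : Fin d) :
    blochMatrix hkM Q (stepSite x i) x = ((Fintype.card (RectTorusSite k) : ℂ))⁻¹ *
      ∑ κ, facePhase κ i (cellPos hkM x) * Q κ (cellPos hkM x + Pi.single i 1) (cellPos hkM x) := by
  rw [blochMatrix_apply]
  simp_rw [blockChar_cellIndex_stepSite_sub, cellPos_stepSite]

/-- Backward bond entries: `P(x, x + eᵢ) = |k|⁻¹ Σ_κ conj θ_κ,i(x̄) · Q κ (x̄, x̄ + eᵢ)`.
[folklore] -/
theorem blochMatrix_stepSite_right (x : FermionTorus d L) (i : Fin d) :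
    blochMatrix hkM Q x (stepSite x i) = ((Fintype.card (RectTorusSite k) : ℂ))⁻¹ *
      ∑ κ, conj (facePhase κ i (cellPos hkM x)) * Q κ (cellPos hkM x) (cellPos hkM x + Pi.single i 1) := by
  rw [blochMatrix_apply]
  simp_rw [show cellIndex hkM x - cellIndex hkM (stepSite x i) = -(cellIndex hkM (stepSite x i) - cellIndex hkM x) by abel,
    blockChar_neg_right, blockChar_cellIndex_stepSite_sub, cellPos_stepSite]

/-! ### The Hartree–Fock functional of a Bloch state -/

/-- **The cell expression for the Hartree–Fock energy of a collinear Bloch state** (`Q σ κ` the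
cell-momentum blocks of spin `σ`):
`blochEnergy = -t Σ_σ Σ_κ Σ_i Σ_{x̄} [θ_κ,i(x̄) Q σ κ (x̄+eᵢ, x̄) + conj θ_κ,i(x̄) Q σ κ (x̄, x̄+eᵢ)]`
`  + U |k| Σ_{x̄} ρ↑(x̄) ρ↓(x̄)`. [cite: BachLiebSolovej1994, eq. (2c.8)] -/
def blochEnergy (t U : ℝ)
    (Q : Fin 2 → RectTorusSite k → Matrix (RectTorusSite M) (RectTorusSite M) ℂ) : ℂ :=
  -(t : ℂ) * (∑ σ, ∑ κ, ∑ i : Fin d, ∑ p : RectTorusSite M,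
      (facePhase κ i p * Q σ κ (p + Pi.single i 1) p +
        conj (facePhase κ i p) * Q σ κ p (p + Pi.single i 1))) +
    (U : ℂ) * (Fintype.card (RectTorusSite k) : ℂ) *
      ∑ p : RectTorusSite M, blochDensity (Q 0) p * blochDensity (Q 1) p

/-- Translating the whole torus by `eᵢ` is a bijection of the fermionic torus. [folklore] -/
def stepEquiv (i : Fin d) : FermionTorus d L ≃ FermionTorus d L :=
  FermionTorus.equivTorusSite.trans ((Equiv.addRight (Pi.single i 1)).trans
    FermionTorus.equivTorusSite.symm)

/-- `stepEquiv i x = x + eᵢ`. [folklore] -/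
theorem stepEquiv_apply (i : Fin d) (x : FermionTorus d L) : stepEquiv i x = stepSite x i := rfl

/-- The kinetic trace of a Bloch state: `tr (K_{-t} P_σ) = -t Σ_i Σ_x [P(x+eᵢ,x) + P(x,x+eᵢ)]`
(`L ≥ 3`). [folklore] -/
theorem trace_hopMatrix_mul_eq (hL : 3 ≤ L) (t : ℝ)
    (P : Matrix (FermionTorus d L) (FermionTorus d L) ℂ) :
    (hopMatrix (fermionTorusGraph d L) (-t) * P).trace =
      -(t : ℂ) *
        ∑ i : Fin d, ∑ x : FermionTorus d L, (P (stepSite x i) x + P x (stepSite x i)) := by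
  have hkin : (hopMatrix (fermionTorusGraph d L) (-t) * P).trace =
      ∑ x, ∑ y, (if (fermionTorusGraph d L).Adj x y then -(t : ℂ) * P y x else 0) := by
    simp only [Matrix.trace, Matrix.diag_apply, Matrix.mul_apply, hopMatrix, Matrix.of_apply,
      ite_mul, zero_mul, Complex.ofReal_neg]
  rw [hkin]
  have hnb : ∀ x : FermionTorus d L,
      (∑ y, if (fermionTorusGraph d L).Adj x y then -(t : ℂ) * P y x else 0) =
        ∑ i : Fin d, (-(t : ℂ) * P (stepSite x i) x +
          -(t : ℂ) * P (FermionTorus.ofTorusSite (x.toTorusSite - Pi.single i 1)) x) := by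
    intro x
    rw [FermionTorus.sum_eq_sum_torusSite]
    simp only [fermionTorusGraph_adj, FermionTorus.toTorusSite_ofTorusSite]
    exact sum_ite_torusGraph_adj hL x.toTorusSite
      (fun z => -(t : ℂ) * P (FermionTorus.ofTorusSite z) x)
  simp_rw [hnb]
  rw [Finset.sum_comm, Finset.mul_sum]
  refine Finset.sum_congr rfl fun i _ => ?_
  rw [Finset.sum_add_distrib, Finset.mul_sum]
  simp_rw [mul_add]
  rw [Finset.sum_add_distrib]
  congr 1
  -- reindex `x ↦ x + eᵢ` in the backward bonds
  refine (Fintype.sum_equiv (stepEquiv i) (fun w => -(t : ℂ) * P w (stepSite w i))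
    (fun x => -(t : ℂ) * P (FermionTorus.ofTorusSite (x.toTorusSite - Pi.single i 1)) x) ?_).symm
  intro w
  simp only [stepEquiv_apply, stepSite, FermionTorus.toTorusSite_ofTorusSite, add_sub_cancel_right,
    FermionTorus.ofTorusSite_toTorusSite]

/-- **The Hartree–Fock energy of a collinear Bloch state is the cell expression `blochEnergy`.**
[cite: BachLiebSolovej1994, eq. (2c.8)] -/
theorem hfEnergy_blochState (hL : 3 ≤ L) (t U : ℝ)
    (Q : Fin 2 → RectTorusSite k → Matrix (RectTorusSite M) (RectTorusSite M) ℂ) :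
    hfEnergy (fermionTorusGraph d L) t U (spinBlock fun σ => blochMatrix hkM (Q σ)) =
      blochEnergy t U Q := by
  set c : ℂ := (Fintype.card (RectTorusSite k) : ℂ) with hc
  have hc0 : c ≠ 0 := card_cells_ne_zero
  rw [hfEnergy_spinBlock, blochEnergy]
  congr 1
  · -- kinetic part
    simp_rw [trace_hopMatrix_mul_eq hL]
    rw [← Finset.mul_sum]
    congr 1
    refine Finset.sum_congr rfl fun σ _ => ?_
    conv_rhs => rw [Finset.sum_comm]
    refine Finset.sum_congr rfl fun i _ => ?_
    rw [sum_eq_sum_cell (A := ℂ) hkM]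
    simp only [blochMatrix_stepSite_left, blochMatrix_stepSite_right, cellPos_ofCellPos]
    rw [Finset.sum_const, Finset.card_univ, nsmul_eq_mul, ← hc]
    conv_rhs => rw [Finset.sum_comm]
    rw [Finset.mul_sum]
    refine Finset.sum_congr rfl fun p _ => ?_
    rw [← mul_add, ← mul_assoc, mul_inv_cancel₀ hc0, one_mul, ← Finset.sum_add_distrib]
  · -- interaction part
    rw [mul_assoc]
    congr 1
    rw [sum_eq_sum_cell (A := ℂ) hkM]
    simp only [blochMatrix_apply_self, cellPos_ofCellPos]
    rw [Finset.sum_const, Finset.card_univ, nsmul_eq_mul, ← hc]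

/-! ### The upper bounds -/

include hkM in
/-- **Hartree–Fock upper bound from a Bloch (magnetic-cell) Slater state.** On the torus
`(ℤ/Lℤ)^d`, `L ≥ 3`, cut into `Π_i k i` cells of sides `M i` (`k i · M i = L`): for every family of
Hermitian idempotent cell-momentum blocks `Q σ κ` (`σ` a spin, `κ ∈ Π_i ℤ/(k i)ℤ`) with
`Σ_{σ,κ} tr Q σ κ = N`,

  `E_{(ℤ/Lℤ)^d}(t, U; N) ≤ re blochEnergy t U Q`
  `= re [ -t Σ_σ Σ_κ Σ_i Σ_{x̄} (θ Q σ κ (x̄+eᵢ,x̄) + conj θ · Q σ κ (x̄,x̄+eᵢ))`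
  `        + U|k| Σ_{x̄} ρ↑(x̄)ρ↓(x̄) ]`

(the Slater determinant with one-body projection `P↑ ⊕ P↓`, `P_σ` the Bloch matrix of `Q σ`;
BLS94 (2c.36) with `γ` this projection). [cite: BachLiebSolovej1994, eq. (2c.36)] -/
theorem hubbardTorus_groundEnergyAt_le_bloch (hL : 3 ≤ L) (t U : ℝ)
    (Q : Fin 2 → RectTorusSite k → Matrix (RectTorusSite M) (RectTorusSite M) ℂ)
    (hQh : ∀ σ κ, (Q σ κ).IsHermitian) (hQP : ∀ σ κ, Q σ κ * Q σ κ = Q σ κ) {N : ℕ}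
    (hN : ∑ σ, ∑ κ, (Q σ κ).trace = N) :
    groundEnergyAt (fermionTorusGraph d L) t U N ≤ (blochEnergy t U Q).re := by
  set P : Matrix (Orb (FermionTorus d L)) (Orb (FermionTorus d L)) ℂ :=
    spinBlock fun σ => blochMatrix hkM (Q σ) with hP
  have hPh : P.IsHermitian := by
    rw [Matrix.IsHermitian, hP, conjTranspose_spinBlock]
    congr 1
    funext σ
    rw [conjTranspose_blochMatrix]
    congr 1
    funext κ
    exact (hQh σ κ).eq
  have hPP : P * P = P := by
    rw [hP, spinBlock_mul_spinBlock]
    congr 1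
    funext σ
    rw [blochMatrix_mul]
    congr 1
    funext κ
    exact hQP σ κ
  have htr : P.trace = N := by
    rw [hP, trace_spinBlock]
    simp_rw [trace_blochMatrix]
    exact hN
  rw [← hfEnergy_blochState hkM hL t U Q]
  exact groundEnergyAt_le_hfEnergy (fermionTorusGraph d L) t U hPh hPP htr

end Bloch

/-! ### Thermodynamic limit on the square lattice -/

section Thermodynamic

variable {L : ℕ} [NeZero L] {k M : Fin 2 → ℕ} [∀ i, NeZero (k i)] [∀ i, NeZero (M i)]

/-- **Bloch-state (unrestricted Hartree–Fock) upper bound on the square-lattice Hubbard energy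
density.** For `U ≥ 0`, `L ≥ 3`, a rectangular magnetic cell `M 0 × M 1` with `k i · M i = L`,
Hermitian idempotent blocks `Q σ κ` with `Σ_{σ,κ} tr Q σ κ = 2m`, `m < L²`:

  `e(t, U; 2m/L²) ≤ re blochEnergy t U Q / L² + 16|t|/L`

(`hubbardTorus_groundEnergyAt_le_bloch` + the tiling bound `ThermodynamicLimit.energyDensity2D_le`).
A certificate supplies `L`, the cell, the `Q σ κ` and an enclosure of `re blochEnergy`.
[cite: BachLiebSolovej1994, eq. (2c.36)] -/
theorem energyDensity2D_le_bloch (hkM : ∀ i, k i * M i = L) (hL : 3 ≤ L) (t : ℝ) {U : ℝ}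
    (hU : 0 ≤ U)
    (Q : Fin 2 → RectTorusSite k → Matrix (RectTorusSite M) (RectTorusSite M) ℂ)
    (hQh : ∀ σ κ, (Q σ κ).IsHermitian) (hQP : ∀ σ κ, Q σ κ * Q σ κ = Q σ κ) {m : ℕ}
    (hm : m < L * L) (hN : ∑ σ, ∑ κ, (Q σ κ).trace = ((2 * m : ℕ) : ℂ)) :
    ThermodynamicLimit.energyDensity2D t U ((2 * m : ℕ) / (L : ℝ) ^ 2) ≤
      (blochEnergy t U Q).re / (L : ℝ) ^ 2 + 16 * |t| / L := by
  have h1 := ThermodynamicLimit.energyDensity2D_le t hU (show 1 ≤ L by omega) hm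
  have h2 := hubbardTorus_groundEnergyAt_le_bloch hkM hL t U Q hQh hQP hN
  rw [groundEnergyAt_fermionTorusGraph_two] at h2
  have hL2 : (0 : ℝ) < (L : ℝ) ^ 2 := by positivity
  have h3 := div_le_div_of_nonneg_right h2 hL2.le
  linarith

end Thermodynamic

end HartreeFock

end Literature.MathematicalPhysics.QuantumLattice
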